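import Literature.AlgebraicGeometry.Motives.CellularPeeling
import Literature.AlgebraicGeometry.Motives.ChowDegree
import Literature.AlgebraicGeometry.Motives.ReducedClosedSubschemeIso
import Literature.AlgebraicGeometry.Motives.GenericFibreRatSpread
import HarnessLib

/-!
# Points of the same degree on a linear subspace of `ℙᴺ_K` are rationally equivalent on it; `Rat₀` of a curve

Two inputs of the "ruled surface" step of Tian–Zong, *One-cycles on rationally connected
varieties*, Compositio Math. 150 (2014), proof of Prop. 3.1 and of Prop. 7.2 ("two sections of a
ruled surface are rationally equivalent modulo rational curves in the fiber"), in the form in which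
the tree spreads rational equivalences from the generic fibre (`Motives/GenericFibreRatSpread`,
generator by generator: a rational function ON a given subvariety of the generic fibre):

* `exists_eq_ord_of_mem_ratTrivial_zero` — **on an integral curve, `Rat₀` consists of principal
  divisors**: if `Y` is integral, locally Noetherian, with generic point of dimension `1`, every
  cycle in `Rat₀(Y)` is `[div g]` for a single `g ∈ K(Y)ˣ` (the generators live on closed
  subvarieties of dimension `1`, which are all of `Y`; `div` is a homomorphism). Fulton,
  *Intersection Theory*, §1.3–1.4 (on a curve `Rat₀` = principal divisors, Example 1.3.1 context).
* `ProjectiveSpaceCells.sub_primeCycle_mem_ratTrivial_of_range_eq_zeroLocus_linear` — **two closed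
  points of the same residue degree on a linear subspace `Λ = V₊(L₁, …, L_t) ⊆ ℙᴺ_K`
  (`t ≤ N`, any field `K`) are rationally equivalent ON `Λ`**: for an integral `Y` with a closed
  immersion `e : Y ↪ ℙᴺ` of image `Λ` and closed points `u, v ∈ Y` with
  `[κ(u) : K] = [κ(v) : K]`, `[u] - [v] ∈ Rat₀(Y)`. Proof: by the cellular decomposition of `Λ`
  (`ChowProjectiveSpaceLines.exists_isRationallyEquivalent_zsmul_of_range_eq_coordSubspace`, any
  `j`, after a linear change of coordinates `exists_linearSubst'`) `[u] - [v] ∼ a • [y₀]` on `Y`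
  for the coordinate point `y₀`; pushing forward to `ℙᴺ` (Fulton Thm. 1.4,
  `map_mem_ratTrivial_holds`) and taking degrees (Fulton Def. 1.4, `ChowGroup.degree`:
  `deg [P] = [κ(P) : K] ≠ 0`) gives `a = 0`.
* `ProjectiveSpaceCells.exists_eq_ord_sub_primeCycle_of_range_eq_line` — the two combined for a
  LINE (`t = N - 1`): `[u] - [v] = [div g]` for some `g ∈ K(Y)ˣ`.

Everything is proved; no named facts.

## References

* [TianZong2014] Z. Tian, H. R. Zong, *One-cycles on rationally connected varieties*, Compositio
  Math. 150 (2014), proofs of Prop. 3.1 and Prop. 7.2.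
* [Fulton1998] W. Fulton, *Intersection Theory*, 2nd ed. (1998), §1.3, Thm. 1.4, Def. 1.4,
  Example 1.9.3.
-/

noncomputable section

open CategoryTheory AlgebraicGeometry Order TopologicalSpace

universe u

namespace Literature.AlgebraicGeometry.Motives

/-! ### On a curve, `Rat₀` consists of principal divisors -/

section Curve

variable {Y : Scheme.{u}} [IsIntegral Y]

/-- On an irreducible scheme whose generic point has dimension `1`, the generic point is the only
point of dimension `1`. [folklore] -/
theorem eq_genericPoint_of_height_eq_one (hY : height (genericPoint Y) = 1) {y : Y}
    (hy : height y = 1) : y = genericPoint Y := by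
  by_contra hne
  have hle : y ≤ genericPoint Y :=
    Scheme.le_iff_specializes.mpr (genericPoint_specializes y)
  have hlt : y < genericPoint Y := lt_of_le_not_ge hle fun hge =>
    hne ((Scheme.le_iff_specializes.mp hge).antisymm (genericPoint_specializes y)).eq
  have h := height_strictMono hlt (by rw [hy]; exact ENat.coe_lt_top 1)
  rw [hy, hY] at h
  exact lt_irrefl _ h

/-- A closed subvariety of dimension `1` of an integral scheme whose generic point has dimension `1`
is everything: its closed immersion is an isomorphism. [folklore] -/
theorem ClosedSubvariety.isIso_ι_of_dim_eq_one (hY : height (_root_.genericPoint Y) = 1)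
    (W : ClosedSubvariety Y) (hW : W.dim = 1) : IsIso W.ι := by
  have hgen : W.genericPoint = _root_.genericPoint Y :=
    eq_genericPoint_of_height_eq_one hY (by exact_mod_cast hW)
  have hrange : Set.range W.ι.base = Set.range (𝟙 Y : Y ⟶ Y).base := by
    rw [Scheme.Hom.id_base, TopCat.coe_id, Set.range_id]
    refine Set.eq_univ_of_univ_subset ?_
    have hcl : closure {_root_.genericPoint Y} ⊆ Set.range W.ι.base := by
      rw [IsClosed.closure_subset_iff W.ι.isClosedEmbedding.isClosed_range, Set.singleton_subset_iff,
        ← hgen]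
      exact ⟨_, rfl⟩
    rwa [genericPoint_closure] at hcl
  obtain ⟨e, he⟩ := exists_iso_of_isClosedImmersion_of_range_eq (𝟙 Y) W.ι hrange.symm
  rw [Category.comp_id] at he
  rw [← he]
  infer_instance

variable [IsLocallyNoetherian Y]

/-- **On an integral curve, every cycle of `Rat₀` is a principal divisor**: for `Y` integral and
locally Noetherian with generic point of dimension `1`, each `c ∈ Rat₀(Y)` satisfies
`c = [div g]`, `c(y) = ord_y(g)`, for one `g ∈ K(Y)ˣ` (generators are divisors on closed subvarieties
of dimension `1`, i.e. on `Y` itself up to the isomorphism `W ≅ Y`, along which orders of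
vanishing agree; and `ord` is multiplicative). [cite: Fulton1998, §1.3] -/
theorem exists_eq_ord_of_mem_ratTrivial_zero (hY : height (genericPoint Y) = 1)
    {c : AlgebraicCycle Y ℤ} (hc : c ∈ ratTrivial Y 0) :
    ∃ g : Y.functionField, g ≠ 0 ∧ ∀ y, c y = Scheme.ord g y := by
  induction hc using AddSubgroup.closure_induction with
  | mem c hc =>
    obtain ⟨-, W, hWn, f, hf, hWdim, hcf⟩ := hc
    haveI := hWn
    have hdim : W.dim = 1 := by rw [hWdim]; norm_num
    haveI : IsIso W.ι := W.isIso_ι_of_dim_eq_one hY hdim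
    haveI : IsDominant W.ι := inferInstance
    obtain ⟨g, rfl⟩ := (functionFieldMap_bijective_of_flat_of_isPreimmersion W.ι).2 f
    have hg : g ≠ 0 := by
      rintro rfl
      exact hf (map_zero _)
    refine ⟨g, hg, fun y => ?_⟩
    obtain ⟨w, rfl⟩ : ∃ w, W.ι.base w = y := W.ι.surjective y
    rw [hcf, W.divFun_ι_base, ord_functionFieldMap_of_flat_of_isPreimmersion]
  | zero =>
    refine ⟨1, one_ne_zero, fun y => ?_⟩
    have h := Scheme.ord_mul (x := y) (one_ne_zero (α := Y.functionField)) one_ne_zero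
    rw [one_mul] at h
    change (0 : ℤ) = Scheme.ord 1 y
    omega
  | add c c' _ _ hc hc' =>
    obtain ⟨g, hg, hcg⟩ := hc
    obtain ⟨g', hg', hcg'⟩ := hc'
    refine ⟨g * g', mul_ne_zero hg hg', fun y => ?_⟩
    rw [Function.locallyFinsuppWithin.coe_add, Pi.add_apply, hcg, hcg', Scheme.ord_mul hg hg']
  | neg c _ hc =>
    obtain ⟨g, hg, hcg⟩ := hc
    refine ⟨g⁻¹, inv_ne_zero hg, fun y => ?_⟩
    have h := Scheme.ord_mul (x := y) hg (inv_ne_zero hg)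
    rw [mul_inv_cancel₀ hg] at h
    have h1 : Scheme.ord (1 : Y.functionField) y = 0 := by
      have h' := Scheme.ord_mul (x := y) (one_ne_zero (α := Y.functionField)) one_ne_zero
      rw [one_mul] at h'
      omega
    rw [Function.locallyFinsuppWithin.coe_neg, Pi.neg_apply, hcg]
    omega

end Curve

/-! ### Points of the same degree on a linear subspace -/

namespace ProjectiveSpaceCells

open _root_.MvPolynomial

variable {k : Type u} [Field k] {N : ℕ}

attribute [local instance] MvPolynomial.gradedAlgebra ProjBaseChange.algebraBase

local notation "𝓐" => MvPolynomial.homogeneousSubmodule (Fin (N + 1)) k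

/-- Push-forward of cycles along a quasi-compact morphism, bundled as a homomorphism (for
`map_zsmul`/`map_sub`). [folklore] -/
private def mapHom' {X Y : Scheme.{u}} (f : X ⟶ Y) [QuasiCompact f] :
    AlgebraicCycle X ℤ →+ AlgebraicCycle Y ℤ :=
  AddMonoidHom.mk' (fun c ↦ AlgebraicCycle.map f height height c) (algebraicCycleMap_add f _ _)

/-- **`0`-cycles on a linear subspace**: for an integral `Y` with a closed immersion `e : Y ↪ ℙᴺ_k`
whose image is `V₊(L₁, …, L_t)` (`Lᵢ` independent linear forms, `t ≤ N`), every `0`-cycle on `Y` is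
rationally equivalent on `Y` to a multiple of the prime cycle of a point `y₀` of dimension `0`
(`x₁ = ⋯ = x_N = 0` after an invertible linear change of coordinates; the case `j = 0` of
`exists_isRationallyEquivalent_zsmul_of_range_eq_coordSubspace`, Fulton Example 1.9.3).
[cite: Fulton1998, Example 1.9.3] -/
theorem exists_isRationallyEquivalent_zsmul_zero_of_range_eq_zeroLocus_linear {t : ℕ} (htN : t ≤ N)
    (L : Fin t → MvPolynomial (Fin (N + 1)) k) (hli : LinearIndependent k L)
    (hL : ∀ a, (L a).IsHomogeneous 1) {Y : Scheme.{u}} [IsIntegral Y] (e : Y ⟶ Proj 𝓐)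
    [IsClosedImmersion e]
    (hrange : Set.range e.base = ProjectiveSpectrum.zeroLocus 𝓐 (Set.range L))
    (c : AlgebraicCycle Y ℤ) (hc : c ∈ cyclesOfDim Y 0) :
    ∃ (y : Y) (a : ℤ), height y = 0 ∧ IsRationallyEquivalent c (a • primeCycle y) 0 := by
  classical
  obtain ⟨τ, τ', hτ, hτ', hinv, hinv', hτL, -⟩ := exists_linearSubst' htN L hL hli
  let σ := ProjectiveSpace.substMapHom τ hτ τ' hτ' hinv
  haveI : IsIso σ := isIso_substMapHom τ hτ τ' hτ' hinv hinv'
  let e₂ := e ≫ σ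
  have hpre : σ.base ⁻¹' coordSubspace k N (N - t) = Set.range e.base := by
    change σ.base ⁻¹' ProjectiveSpectrum.zeroLocus _ _ = _
    rw [substMapHom_preimage_zeroLocus, hrange]
    congr 1
    ext f
    simp only [Set.mem_image, Set.mem_setOf_eq, Set.mem_range, exists_exists_and_eq_and,
      MvPolynomial.aeval_X]
    constructor
    · rintro ⟨j, hj, rfl⟩
      refine ⟨⟨j - (N - t + 1), by omega⟩, ?_⟩
      rw [← hτL]
      congr 1
      exact Fin.ext (by simp; omega)
    · rintro ⟨a, rfl⟩
      exact ⟨⟨N - t + 1 + a, by omega⟩, by simp; omega, hτL a⟩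
  have hrange₂ : Set.range e₂.base = coordSubspace k N (N - t + 0) := by
    rw [add_zero, Scheme.Hom.comp_base, TopCat.coe_comp, Set.range_comp, ← hpre]
    exact Set.image_preimage_eq _ σ.homeomorph.surjective
  obtain ⟨y, a, hy, hrat⟩ := exists_isRationallyEquivalent_zsmul_of_range_eq_coordSubspace k 0
    (N - t) (by omega) e₂ hrange₂ c hc
  refine ⟨y, a, ?_, hrat⟩
  rw [← height_base_eq_of_isClosedImmersion' e₂ y, hy]
  simpa using height_coordGenericPoint k (n := N) (m := 0) (Nat.zero_le N)

/-- **Two closed points of the same degree on a linear subspace of `ℙᴺ_k` are rationally equivalent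
on it.** With `Y`, `e`, `L` as above (`t ≤ N`, any field `k`) and closed points `u, v ∈ Y` whose
residue degrees over `k` (computed on `ℙᴺ`) agree — e.g. two `k`-rational points — the `0`-cycle
`[u] - [v]` lies in `Rat₀(Y)`. Proof: `[u] - [v] ∼ a • [y₀]` on `Y` (previous lemma); push forward to
`ℙᴺ` (Fulton Thm. 1.4, `map_mem_ratTrivial_holds`) and apply the degree `deg : CH₀(ℙᴺ) → ℤ`
(Fulton Def. 1.4, `ChowGroup.degree`): `deg [u] - deg [v] - a deg [y₀] = 0` with
`deg [y₀] ≠ 0`, so `a = 0`. (Tian–Zong use it as "two sections of a ruled surface are rationally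
equivalent modulo … the fiber", on the generic fibre.) [cite: Fulton1998, Thm. 1.4 and Def. 1.4]
[cite: TianZong2014, proof of Prop. 3.1] -/
theorem sub_primeCycle_mem_ratTrivial_of_range_eq_zeroLocus_linear {t : ℕ} (htN : t ≤ N)
    (L : Fin t → MvPolynomial (Fin (N + 1)) k) (hli : LinearIndependent k L)
    (hL : ∀ a, (L a).IsHomogeneous 1) {Y : Scheme.{u}} [IsIntegral Y] (e : Y ⟶ Proj 𝓐)
    [IsClosedImmersion e]
    (hrange : Set.range e.base = ProjectiveSpectrum.zeroLocus 𝓐 (Set.range L))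
    {u v : Y} (hu : height u = 0) (hv : height v = 0)
    (hdeg : (projectiveSpace N k).hom.residueDegree (e.base u) =
      (projectiveSpace N k).hom.residueDegree (e.base v)) :
    primeCycle u - primeCycle v ∈ ratTrivial Y 0 := by
  classical
  have hc : primeCycle u - primeCycle v ∈ cyclesOfDim Y 0 :=
    (cyclesOfDim Y 0).sub_mem (primeCycle_mem_cyclesOfDim hu) (primeCycle_mem_cyclesOfDim hv)
  obtain ⟨y, a, hy, hrat⟩ :=
    exists_isRationallyEquivalent_zsmul_zero_of_range_eq_zeroLocus_linear htN L hli hL e hrange _ hc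
  -- push forward to `ℙᴺ`
  let P : SchemeOver k := projectiveSpace N k
  let e' : Y ⟶ P.left := e
  haveI : IsClosedImmersion e' := ‹IsClosedImmersion e›
  let YO : SchemeOver k := Over.mk (e' ≫ P.hom)
  let f : YO ⟶ P := Over.homMk e' rfl
  haveI : IsProper f.left := inferInstanceAs (IsProper e')
  haveI : IsProper P.hom := isProper_projectiveSpace N k
  haveI : LocallyOfFiniteType P.hom := inferInstance
  haveI : LocallyOfFiniteType YO.hom := inferInstanceAs (LocallyOfFiniteType (e' ≫ P.hom))
  have hpush := map_mem_ratTrivial_holds 0 f hrat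
  have hmap : AlgebraicCycle.map f.left height height (primeCycle u - primeCycle v - a • primeCycle y)
      = primeCycle (e'.base u) - primeCycle (e'.base v) - a • primeCycle (e'.base y) := by
    change mapHom' e' (primeCycle u - primeCycle v - a • primeCycle y) = _
    rw [map_sub, map_sub, map_zsmul]
    change AlgebraicCycle.map e' height height _ - AlgebraicCycle.map e' height height _ -
      a • AlgebraicCycle.map e' height height _ = _
    rw [algebraicCycleMap_primeCycle, algebraicCycleMap_primeCycle, algebraicCycleMap_primeCycle]
  rw [hmap] at hpush
  -- degrees
  have hu' : height (e'.base u) = 0 := by rw [height_base_eq_of_isClosedImmersion' e' u, hu]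
  have hv' : height (e'.base v) = 0 := by rw [height_base_eq_of_isClosedImmersion' e' v, hv]
  have hy' : height (e'.base y) = 0 := by rw [height_base_eq_of_isClosedImmersion' e' y, hy]
  have hcls : ChowGroup.ofPoint (X := P.left) (e'.base u) hu' -
      ChowGroup.ofPoint (X := P.left) (e'.base v) hv' -
        a • ChowGroup.ofPoint (X := P.left) (e'.base y) hy' = 0 := by
    simp only [ChowGroup.ofPoint, ← map_zsmul, ← map_sub, ChowGroup.mk_eq_zero_iff]
    exact hpush
  have hdeg0 := congrArg (ChowGroup.degree P) hcls
  rw [map_sub, map_sub, map_zsmul, ChowGroup.degree_ofPoint, ChowGroup.degree_ofPoint,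
    ChowGroup.degree_ofPoint, map_zero] at hdeg0
  change ((projectiveSpace N k).hom.residueDegree (e.base u) : ℤ) -
    (projectiveSpace N k).hom.residueDegree (e.base v) -
      a • ((projectiveSpace N k).hom.residueDegree (e.base y) : ℤ) = 0 at hdeg0
  rw [hdeg, sub_self, zero_sub, neg_eq_zero, smul_eq_mul, mul_eq_zero] at hdeg0
  have hne : ((projectiveSpace N k).hom.residueDegree (e.base y) : ℤ) ≠ 0 := by
    exact_mod_cast CartierDivisor.residueDegree_toSpecOver_ne_zero (C := P) hy'
  have ha : a = 0 := hdeg0.resolve_right hne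
  rw [ha, zero_smul] at hrat
  simpa [IsRationallyEquivalent] using hrat

/-- **Two rational points on a line are joined by a principal divisor on the line**: for an integral
`Y` with a closed immersion `e : Y ↪ ℙᴺ_k` (`N ≥ 1`) of image a line `V₊(L₁, …, L_{N-1})` and closed
points `u, v` of the same residue degree over `k`, there is
`g ∈ K(Y)ˣ` with `[u] - [v] = [div g]` on `Y` — the generator form required to spread the relation
from the generic fibre (`Motives/GenericFibreRatSpread`). [cite: TianZong2014, proof of Prop. 3.1]
[cite: Fulton1998, §1.3 and Thm. 1.4] -/
theorem exists_eq_ord_sub_primeCycle_of_range_eq_line (hN : 1 ≤ N)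
    (L : Fin (N - 1) → MvPolynomial (Fin (N + 1)) k) (hli : LinearIndependent k L)
    (hL : ∀ a, (L a).IsHomogeneous 1) {Y : Scheme.{u}} [IsIntegral Y] (e : Y ⟶ Proj 𝓐)
    [IsClosedImmersion e] [IsLocallyNoetherian Y]
    (hrange : Set.range e.base = ProjectiveSpectrum.zeroLocus 𝓐 (Set.range L))
    {u v : Y} (hu : height u = 0) (hv : height v = 0)
    (hdeg : (projectiveSpace N k).hom.residueDegree (e.base u) =
      (projectiveSpace N k).hom.residueDegree (e.base v)) :
    ∃ g : Y.functionField, g ≠ 0 ∧ ∀ y, (primeCycle u - primeCycle v) y = Scheme.ord g y := by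
  have hmem := sub_primeCycle_mem_ratTrivial_of_range_eq_zeroLocus_linear (by omega) L hli hL e
    hrange hu hv hdeg
  -- `Y` is a curve: its generic point maps to the generic point of the line, of dimension `1`
  let P : SchemeOver k := projectiveSpace N k
  let e' : Y ⟶ P.left := e
  haveI : IsClosedImmersion e' := ‹IsClosedImmersion e›
  have hrange' : Set.range e'.base = ProjectiveSpectrum.zeroLocus 𝓐 (Set.range L) := hrange
  have hY : height (genericPoint Y) = 1 := by
    rw [← height_base_eq_of_isClosedImmersion' e' (genericPoint Y)]
    have hgen : e'.base (genericPoint Y) = linearSubspacePoint L hli hL (by omega) := by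
      apply eq_linearSubspacePoint_of_closure_eq
      rw [← Set.image_singleton, e'.isClosedEmbedding.closure_image_eq, genericPoint_closure,
        Set.image_univ, hrange']
    rw [hgen, height_linearSubspacePoint, show N - (N - 1) = 1 by omega, Nat.cast_one]
  exact exists_eq_ord_of_mem_ratTrivial_zero hY hmem

end ProjectiveSpaceCells

end Literature.AlgebraicGeometry.Motives

end
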